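import Summits.QuantumFields.YangMills.Theorems.AtomicCalibrationRAdmissible

/-!
# AtomicCalibrationR (stmt-QuantumFields-28169), E2 `stub_offDiagonalWhitney` — meshes, rates and the level constants of construction (T)
# (roadmap v2 items B.3/B.4, arithmetic layer; prover w4 g23, free hands)

Construction (T) at separation ratio `Λ ≥ 1` uses the dyadic meshes `h_k = 2^{−k}/(8(Λ+1))` (radius `ρ_k = 2h_k`), the Gevrey rates
of `GevreyBandBump` (`R_{k+1} = 2·n²·8C₀'C₁'·2^{k+1} + 4nC₀C₁/h_{k+1}` for the band bumps, `R_0 = n²·8C₀'C₁' + 4nC₀C₁/h_0` for the far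
bumps) and feeds them to `GevreyLevelMass` / `GevreyFarLevelMass`.  This file is the arithmetic that makes the level masses uniform in
`k` and admissible in `n`:

* mesh facts: `mesh_pos`, `two_mesh_le_half`, `mesh_le_one`, `sep_mesh` (`4(Λ+1)h_k ≤ 2^{−k}`), `three_div_mesh` (`3/h_k = 24(Λ+1)2^k`);
* rate facts: `inv_pow_mul_bandRate` (`2^{−k}R_{k+1} = 32C₀'C₁'n² + 64C₀C₁(Λ+1)n =: Q`), `two_mesh_mul_bandRate_le` (`2h_{k+1}R_{k+1} ≤ Q`),
  `pow_le_bandRate` (`2^{k+2} ≤ R_{k+1}`), `two_mesh_mul_farRate_le` (`2h_0(1+R_0) ≤ 1+Q`), `ceil_ratio_le` (the shell-count ratio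
  `2⌈δ_k/h_{k+1}⌉₊+1 ≤ 64(Λ+1)+11`), `dyadic_gain_le` (`(2^k)^{4n−4}(2^{−k})^{K} ≤ 2^{−k}` for `K ≥ 4n−3`);
* `adm_levelConst` — the sum of the far and band level constants is admissible (`≤ α Cⁿ (n!)^γ`, via `AtomicCalibrationRAdmissible`).

No definitions; no stub/crux/rung/summit is closed; nothing here touches Yang–Mills; the YM mass gap is NOT proved. [folklore]
-/

set_option autoImplicit false

noncomputable section

open scoped Nat

namespace Summit.QuantumFields.YangMills.Cruxes.AtomicCalibrationR.LevelConstants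

variable {Λ : ℝ}

/-! ## Meshes `h_k = 2^{-k} / (8(Λ+1))` -/

/-- `0 < h_k`. -/
theorem mesh_pos (hΛ : 1 ≤ Λ) (k : ℕ) : 0 < (2 : ℝ)⁻¹ ^ k / (8 * (Λ + 1)) := by
  have hL : 0 < Λ + 1 := by linarith
  positivity

/-- `2^{-k} ≤ 1`. -/
theorem inv_two_pow_le_one (k : ℕ) : (2 : ℝ)⁻¹ ^ k ≤ 1 := pow_le_one₀ (by norm_num) (by norm_num)

/-- `2 h_k ≤ 1/2` (clause (ii) of `WhitneyPkg` for the radius `ρ_k = 2h_k`). -/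
theorem two_mesh_le_half (hΛ : 1 ≤ Λ) (k : ℕ) : 2 * ((2 : ℝ)⁻¹ ^ k / (8 * (Λ + 1))) ≤ 1 / 2 := by
  have hL : 0 < Λ + 1 := by linarith
  have h1 := inv_two_pow_le_one k
  rw [mul_div_assoc', div_le_iff₀ (by positivity)]
  nlinarith

/-- `h_k ≤ 1`. -/
theorem mesh_le_one (hΛ : 1 ≤ Λ) (k : ℕ) : (2 : ℝ)⁻¹ ^ k / (8 * (Λ + 1)) ≤ 1 := by
  have := two_mesh_le_half hΛ k
  have := mesh_pos hΛ k
  linarith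

/-- The Whitney ratio constraint `4(Λ+1) h_k ≤ 2^{-k}` (indeed `= 2^{-k}/2`). -/
theorem sep_mesh (hΛ : 1 ≤ Λ) (k : ℕ) : 4 * (Λ + 1) * ((2 : ℝ)⁻¹ ^ k / (8 * (Λ + 1))) ≤ (2 : ℝ)⁻¹ ^ k := by
  have hL : 0 < Λ + 1 := by linarith
  have h0 : 0 ≤ (2 : ℝ)⁻¹ ^ k := by positivity
  rw [show 4 * (Λ + 1) * ((2 : ℝ)⁻¹ ^ k / (8 * (Λ + 1))) = (2 : ℝ)⁻¹ ^ k / 2 by field_simp; ring]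
  linarith

/-- `3 / h_k = 24 (Λ+1) 2^k`. -/
theorem three_div_mesh (hΛ : 1 ≤ Λ) (k : ℕ) : 3 / ((2 : ℝ)⁻¹ ^ k / (8 * (Λ + 1))) = 24 * (Λ + 1) * 2 ^ k := by
  have hL : 0 < Λ + 1 := by linarith
  rw [inv_pow]
  field_simp
  ring

/-- `2^{-k} / h_{k+1} = 16 (Λ+1)`. -/
theorem inv_pow_div_mesh_succ (hΛ : 1 ≤ Λ) (k : ℕ) :
    (2 : ℝ)⁻¹ ^ k / ((2 : ℝ)⁻¹ ^ (k + 1) / (8 * (Λ + 1))) = 16 * (Λ + 1) := by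
  have hL : 0 < Λ + 1 := by linarith
  have h2 : (2 : ℝ)⁻¹ ^ k ≠ 0 := by positivity
  rw [pow_succ]
  field_simp
  ring

/-! ## Rates -/

variable {C₀ C₁ C₀' C₁' : ℝ}

/-- `2^{-k} · R_{k+1} = 32 C₀'C₁' n² + 64 C₀C₁(Λ+1) n` (the `k`-uniform combination entering `(1 + 2^{-k}R)^{N'n}`). -/
theorem inv_pow_mul_bandRate (hΛ : 1 ≤ Λ) (n k : ℕ) :
    (2 : ℝ)⁻¹ ^ k * (2 * ((n : ℝ) ^ 2 * (8 * C₀' * C₁' * (2 : ℝ) ^ (k + 1))) +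
      4 * n * (C₀ * C₁ / ((2 : ℝ)⁻¹ ^ (k + 1) / (8 * (Λ + 1))))) =
      32 * C₀' * C₁' * (n : ℝ) ^ 2 + 64 * C₀ * C₁ * (Λ + 1) * n := by
  have hL : 0 < Λ + 1 := by linarith
  have hkey : (2 : ℝ)⁻¹ ^ k * (2 : ℝ) ^ (k + 1) = 2 := by
    rw [pow_succ, ← mul_assoc, ← mul_pow, inv_mul_cancel₀ (by norm_num : (2 : ℝ) ≠ 0), one_pow, one_mul]
  have hdiv : C₀ * C₁ / ((2 : ℝ)⁻¹ ^ (k + 1) / (8 * (Λ + 1))) = C₀ * C₁ * (8 * (Λ + 1)) * (2 : ℝ) ^ (k + 1) := by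
    rw [inv_pow, div_div_eq_mul_div, div_eq_mul_inv, inv_inv]
  rw [hdiv]
  have : (2 : ℝ)⁻¹ ^ k * (2 * ((n : ℝ) ^ 2 * (8 * C₀' * C₁' * (2 : ℝ) ^ (k + 1))) +
      4 * n * (C₀ * C₁ * (8 * (Λ + 1)) * (2 : ℝ) ^ (k + 1))) =
      ((2 : ℝ)⁻¹ ^ k * (2 : ℝ) ^ (k + 1)) * (16 * C₀' * C₁' * (n : ℝ) ^ 2 + 32 * C₀ * C₁ * (Λ + 1) * n) := by ring
  rw [this, hkey]; ring

/-- `2 h_{k+1} · R_{k+1} ≤ 32 C₀'C₁' n² + 64 C₀C₁(Λ+1) n`. -/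
theorem two_mesh_mul_bandRate_le (hΛ : 1 ≤ Λ) (hC₀ : 0 ≤ C₀) (hC₁ : 0 ≤ C₁) (hC₀' : 0 ≤ C₀') (hC₁' : 0 ≤ C₁') (n k : ℕ) :
    2 * ((2 : ℝ)⁻¹ ^ (k + 1) / (8 * (Λ + 1))) * (2 * ((n : ℝ) ^ 2 * (8 * C₀' * C₁' * (2 : ℝ) ^ (k + 1))) +
      4 * n * (C₀ * C₁ / ((2 : ℝ)⁻¹ ^ (k + 1) / (8 * (Λ + 1))))) ≤
      32 * C₀' * C₁' * (n : ℝ) ^ 2 + 64 * C₀ * C₁ * (Λ + 1) * n := by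
  have hL : 1 ≤ Λ + 1 := by linarith
  have hL0 : 0 < Λ + 1 := by linarith
  have hkey : (2 : ℝ)⁻¹ ^ (k + 1) * (2 : ℝ) ^ (k + 1) = 1 := by
    rw [← mul_pow, inv_mul_cancel₀ (by norm_num : (2 : ℝ) ≠ 0), one_pow]
  have hh : (2 : ℝ)⁻¹ ^ (k + 1) / (8 * (Λ + 1)) ≠ 0 := (mesh_pos hΛ (k + 1)).ne'
  have hexp : 2 * ((2 : ℝ)⁻¹ ^ (k + 1) / (8 * (Λ + 1))) * (2 * ((n : ℝ) ^ 2 * (8 * C₀' * C₁' * (2 : ℝ) ^ (k + 1))) +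
      4 * n * (C₀ * C₁ / ((2 : ℝ)⁻¹ ^ (k + 1) / (8 * (Λ + 1))))) =
      ((2 : ℝ)⁻¹ ^ (k + 1) * (2 : ℝ) ^ (k + 1)) * (4 * C₀' * C₁' * (n : ℝ) ^ 2) / (Λ + 1) + 8 * C₀ * C₁ * n := by
    field_simp
    ring
  rw [hexp, hkey, one_mul]
  have hn0 : (0 : ℝ) ≤ n := Nat.cast_nonneg n
  have h1 : 4 * C₀' * C₁' * (n : ℝ) ^ 2 / (Λ + 1) ≤ 4 * C₀' * C₁' * (n : ℝ) ^ 2 := div_le_self (by positivity) hL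
  have h2 : 4 * C₀' * C₁' * (n : ℝ) ^ 2 ≤ 32 * C₀' * C₁' * (n : ℝ) ^ 2 := by nlinarith [mul_nonneg hC₀' hC₁', sq_nonneg (n : ℝ)]
  have h3 : 8 * C₀ * C₁ * (n : ℝ) ≤ 64 * C₀ * C₁ * (Λ + 1) * n := by nlinarith [mul_nonneg (mul_nonneg hC₀ hC₁) hn0]
  linarith

/-- `2^{k+2} ≤ R_{k+1}` (the flatness threshold of `GevreyBandPiece`), for `n ≥ 1` and Gevrey constants `≥ 1`. -/
theorem pow_le_bandRate (hΛ : 1 ≤ Λ) (hC₀ : 1 ≤ C₀) (hC₁ : 1 ≤ C₁) (hC₀' : 1 ≤ C₀') (hC₁' : 1 ≤ C₁') {n : ℕ} (hn : 1 ≤ n)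
    (k : ℕ) : (2 : ℝ) ^ (k + 2) ≤ 2 * ((n : ℝ) ^ 2 * (8 * C₀' * C₁' * (2 : ℝ) ^ (k + 1))) +
      4 * n * (C₀ * C₁ / ((2 : ℝ)⁻¹ ^ (k + 1) / (8 * (Λ + 1)))) := by
  have hn1 : (1 : ℝ) ≤ n := by exact_mod_cast hn
  have hn2 : (1 : ℝ) ≤ (n : ℝ) ^ 2 := one_le_pow₀ hn1
  have hCC : (1 : ℝ) ≤ C₀' * C₁' := by nlinarith
  have h2 : (0 : ℝ) ≤ (2 : ℝ) ^ (k + 1) := by positivity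
  have hsecond : 0 ≤ 4 * n * (C₀ * C₁ / ((2 : ℝ)⁻¹ ^ (k + 1) / (8 * (Λ + 1)))) := by
    have := mesh_pos hΛ (k + 1)
    have : (0 : ℝ) ≤ C₀ * C₁ := by nlinarith
    positivity
  have hfirst : (2 : ℝ) ^ (k + 2) ≤ 2 * ((n : ℝ) ^ 2 * (8 * C₀' * C₁' * (2 : ℝ) ^ (k + 1))) := by
    rw [pow_succ]
    have : (2 : ℝ) ^ (k + 1) ≤ (n : ℝ) ^ 2 * (8 * C₀' * C₁' * (2 : ℝ) ^ (k + 1)) := by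
      calc (2 : ℝ) ^ (k + 1) = 1 * (1 * (2 : ℝ) ^ (k + 1)) := by ring
        _ ≤ (n : ℝ) ^ 2 * (8 * C₀' * C₁' * (2 : ℝ) ^ (k + 1)) := by
            refine mul_le_mul hn2 (mul_le_mul_of_nonneg_right (by nlinarith) h2) (by positivity) (by positivity)
    nlinarith
  linarith

/-- `0 < R_0`. -/
theorem farRate_pos (hΛ : 1 ≤ Λ) (hC₀ : 1 ≤ C₀) (hC₁ : 1 ≤ C₁) (hC₀' : 1 ≤ C₀') (hC₁' : 1 ≤ C₁') {n : ℕ} (hn : 1 ≤ n) :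
    0 < (n : ℝ) ^ 2 * (8 * C₀' * C₁') + 4 * n * (C₀ * C₁ / ((2 : ℝ)⁻¹ ^ 0 / (8 * (Λ + 1)))) := by
  have hn1 : (1 : ℝ) ≤ n := by exact_mod_cast hn
  have hm := mesh_pos hΛ 0
  have : (0 : ℝ) < C₀ * C₁ := by nlinarith
  have : (0 : ℝ) < C₀' * C₁' := by nlinarith
  positivity

/-- `2 h_0 (1 + R_0) ≤ 1 + 32 C₀'C₁' n² + 64 C₀C₁(Λ+1) n`. -/
theorem two_mesh_mul_farRate_le (hΛ : 1 ≤ Λ) (hC₀ : 0 ≤ C₀) (hC₁ : 0 ≤ C₁) (hC₀' : 0 ≤ C₀') (hC₁' : 0 ≤ C₁') (n : ℕ) :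
    2 * ((2 : ℝ)⁻¹ ^ 0 / (8 * (Λ + 1))) * (1 + ((n : ℝ) ^ 2 * (8 * C₀' * C₁') +
      4 * n * (C₀ * C₁ / ((2 : ℝ)⁻¹ ^ 0 / (8 * (Λ + 1)))))) ≤
      1 + 32 * C₀' * C₁' * (n : ℝ) ^ 2 + 64 * C₀ * C₁ * (Λ + 1) * n := by
  have hL : 1 ≤ Λ + 1 := by linarith
  have hL0 : 0 < Λ + 1 := by linarith
  have hexp : 2 * ((2 : ℝ)⁻¹ ^ 0 / (8 * (Λ + 1))) * (1 + ((n : ℝ) ^ 2 * (8 * C₀' * C₁') +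
      4 * n * (C₀ * C₁ / ((2 : ℝ)⁻¹ ^ 0 / (8 * (Λ + 1)))))) =
      (1 + (n : ℝ) ^ 2 * (8 * C₀' * C₁')) / (4 * (Λ + 1)) + 8 * C₀ * C₁ * n := by
    rw [pow_zero]
    field_simp
    ring
  rw [hexp]
  have hn0 : (0 : ℝ) ≤ n := Nat.cast_nonneg n
  have hnum : 0 ≤ 1 + (n : ℝ) ^ 2 * (8 * C₀' * C₁') := by positivity
  have h1 : (1 + (n : ℝ) ^ 2 * (8 * C₀' * C₁')) / (4 * (Λ + 1)) ≤ 1 + (n : ℝ) ^ 2 * (8 * C₀' * C₁') :=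
    div_le_self hnum (by linarith)
  have h2 : (n : ℝ) ^ 2 * (8 * C₀' * C₁') ≤ 32 * C₀' * C₁' * (n : ℝ) ^ 2 := by
    nlinarith [mul_nonneg hC₀' hC₁', sq_nonneg (n : ℝ)]
  have h3 : 8 * C₀ * C₁ * (n : ℝ) ≤ 64 * C₀ * C₁ * (Λ + 1) * n := by nlinarith [mul_nonneg (mul_nonneg hC₀ hC₁) hn0]
  linarith

/-- The shell-count ratio of level `k+1` is `k`-uniform: `2⌈δ_k/h_{k+1}⌉₊ + 1 ≤ 64(Λ+1) + 11`, `δ_k = 2·2^{-k} + 4h_{k+1}`. -/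
theorem ceil_ratio_le (hΛ : 1 ≤ Λ) (k : ℕ) :
    (2 * (⌈(2 * (2 : ℝ)⁻¹ ^ k + 4 * ((2 : ℝ)⁻¹ ^ (k + 1) / (8 * (Λ + 1)))) /
      ((2 : ℝ)⁻¹ ^ (k + 1) / (8 * (Λ + 1)))⌉₊ : ℝ) + 1) ≤ 64 * (Λ + 1) + 11 := by
  have hL0 : 0 < Λ + 1 := by linarith
  have hm := mesh_pos hΛ (k + 1)
  have hratio : (2 * (2 : ℝ)⁻¹ ^ k + 4 * ((2 : ℝ)⁻¹ ^ (k + 1) / (8 * (Λ + 1)))) /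
      ((2 : ℝ)⁻¹ ^ (k + 1) / (8 * (Λ + 1))) = 32 * (Λ + 1) + 4 := by
    rw [add_div, mul_div_assoc, inv_pow_div_mesh_succ hΛ k, mul_div_assoc, div_self hm.ne']
    ring
  rw [hratio]
  have hx : (0 : ℝ) ≤ 32 * (Λ + 1) + 4 := by positivity
  have hceil : (⌈32 * (Λ + 1) + 4⌉₊ : ℝ) < 32 * (Λ + 1) + 4 + 1 := Nat.ceil_lt_add_one hx
  linarith

/-- The dyadic gain of the band levels beats the shell-count growth: `(2^k)^{a} · (2^{-k})^{K} ≤ 2^{-k}` whenever `a + 1 ≤ K`. -/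
theorem dyadic_gain_le {a K : ℕ} (haK : a + 1 ≤ K) (k : ℕ) :
    ((2 : ℝ) ^ k) ^ a * ((2 : ℝ)⁻¹ ^ k) ^ K ≤ (2 : ℝ)⁻¹ ^ k := by
  obtain ⟨b, rfl⟩ : ∃ b, K = a + 1 + b := ⟨K - (a + 1), by omega⟩
  rw [pow_add, pow_add, pow_one, ← mul_assoc, ← mul_assoc, ← mul_pow, ← mul_pow,
    mul_inv_cancel₀ (by norm_num : (2 : ℝ) ≠ 0), one_pow, one_pow, one_mul]
  have h1 : ((2 : ℝ)⁻¹ ^ k) ^ b ≤ 1 := pow_le_one₀ (by positivity) (inv_two_pow_le_one k)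
  have h0 : 0 ≤ (2 : ℝ)⁻¹ ^ k := by positivity
  calc (2 : ℝ)⁻¹ ^ k * ((2 : ℝ)⁻¹ ^ k) ^ b ≤ (2 : ℝ)⁻¹ ^ k * 1 := mul_le_mul_of_nonneg_left h1 h0
    _ = (2 : ℝ)⁻¹ ^ k := mul_one _

/-! ## Admissibility of the level constants -/

/-- **The level constants are admissible.**  The far-level constant plus (twice) the `k`-uniform band-level constant of construction
(T) is bounded by `α Cⁿ (n!)^γ` for `n ≥ 1`, with `α, C, γ` depending only on `Λ, N', s` and the Gevrey constants. -/
theorem adm_levelConst (Λ : ℝ) (N' s : ℕ) (hC₀ : 0 ≤ C₀) (hC₁ : 0 ≤ C₁) (hC₀' : 0 ≤ C₀') (hC₁' : 0 ≤ C₁') (hL : 0 ≤ Λ + 1) :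
    ∃ α C : ℝ, ∃ γ : ℕ, 0 ≤ α ∧ 0 ≤ C ∧ ∀ n : ℕ, 1 ≤ n →
      2 ^ (4 * n + 1) * (24 * (Λ + 1)) ^ (4 * n) * ((((N' * n) ! : ℕ) : ℝ) ^ (s + 1) *
          (2 ^ (N' * n + 4 * n + 2) * 2 ^ (4 * n + 2) *
            (1 + 32 * C₀' * C₁' * (n : ℝ) ^ 2 + 64 * C₀ * C₁ * (Λ + 1) * n) ^ (N' * n))) +
        2 * (2 ^ (4 * n) * ((n : ℝ) ^ 2 * (64 * (Λ + 1) + 11) ^ 4 * (48 * (Λ + 1)) ^ (4 * n)) *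
          ((((N' * n) ! : ℕ) : ℝ) ^ (s + 1) * (2 ^ (N' * n + 4 * n + 2) * 4 ^ (4 * n) *
            (1 + 32 * C₀' * C₁' * (n : ℝ) ^ 2 + 64 * C₀ * C₁ * (Λ + 1) * n) ^ (N' * n) *
            (1 + 32 * C₀' * C₁' * (n : ℝ) ^ 2 + 64 * C₀ * C₁ * (Λ + 1) * n) ^ (N' * n)))) ≤
        α * C ^ n * (n ! : ℝ) ^ γ := by
  have hA : 0 ≤ 32 * C₀' * C₁' := by positivity
  have hB : 0 ≤ 64 * C₀ * C₁ * (Λ + 1) := by positivity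
  -- the atoms
  have aQ : ∃ α C : ℝ, ∃ γ : ℕ, 0 ≤ α ∧ 0 ≤ C ∧ ∀ n : ℕ, 1 ≤ n →
      (1 + 32 * C₀' * C₁' * (n : ℝ) ^ 2 + 64 * C₀ * C₁ * (Λ + 1) * n) ^ (N' * n) ≤ α * C ^ n * (n ! : ℝ) ^ γ :=
    Admissible.of_le_quadPow hA hB N' fun n _ => le_rfl
  have hQ0 : ∀ n : ℕ, 1 ≤ n → 0 ≤ (1 + 32 * C₀' * C₁' * (n : ℝ) ^ 2 + 64 * C₀ * C₁ * (Λ + 1) * n) ^ (N' * n) :=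
    fun n _ => by positivity
  have aFac : ∃ α C : ℝ, ∃ γ : ℕ, 0 ≤ α ∧ 0 ≤ C ∧ ∀ n : ℕ, 1 ≤ n →
      (((N' * n) ! : ℕ) : ℝ) ^ (s + 1) ≤ α * C ^ n * (n ! : ℝ) ^ γ :=
    Admissible.of_le_factorialMul N' (s + 1) fun n _ => le_rfl
  have a2K : ∃ α C : ℝ, ∃ γ : ℕ, 0 ≤ α ∧ 0 ≤ C ∧ ∀ n : ℕ, 1 ≤ n →
      (2 : ℝ) ^ (N' * n + 4 * n + 2) ≤ α * C ^ n * (n ! : ℝ) ^ γ :=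
    Admissible.of_le_pow (by norm_num : (0 : ℝ) ≤ 2) (N' + 4) 2 fun n _ => by rw [add_mul]
  have a2a : ∃ α C : ℝ, ∃ γ : ℕ, 0 ≤ α ∧ 0 ≤ C ∧ ∀ n : ℕ, 1 ≤ n →
      (2 : ℝ) ^ (4 * n + 1) ≤ α * C ^ n * (n ! : ℝ) ^ γ :=
    Admissible.of_le_pow (by norm_num : (0 : ℝ) ≤ 2) 4 1 fun n _ => le_rfl
  have a2b : ∃ α C : ℝ, ∃ γ : ℕ, 0 ≤ α ∧ 0 ≤ C ∧ ∀ n : ℕ, 1 ≤ n →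
      (2 : ℝ) ^ (4 * n + 2) ≤ α * C ^ n * (n ! : ℝ) ^ γ :=
    Admissible.of_le_pow (by norm_num : (0 : ℝ) ≤ 2) 4 2 fun n _ => le_rfl
  have a2c : ∃ α C : ℝ, ∃ γ : ℕ, 0 ≤ α ∧ 0 ≤ C ∧ ∀ n : ℕ, 1 ≤ n →
      (2 : ℝ) ^ (4 * n) ≤ α * C ^ n * (n ! : ℝ) ^ γ :=
    Admissible.of_le_pow (by norm_num : (0 : ℝ) ≤ 2) 4 0 fun n _ => by rw [add_zero]
  have a4 : ∃ α C : ℝ, ∃ γ : ℕ, 0 ≤ α ∧ 0 ≤ C ∧ ∀ n : ℕ, 1 ≤ n →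
      (4 : ℝ) ^ (4 * n) ≤ α * C ^ n * (n ! : ℝ) ^ γ :=
    Admissible.of_le_pow (by norm_num : (0 : ℝ) ≤ 4) 4 0 fun n _ => by rw [add_zero]
  have a24 : ∃ α C : ℝ, ∃ γ : ℕ, 0 ≤ α ∧ 0 ≤ C ∧ ∀ n : ℕ, 1 ≤ n →
      (24 * (Λ + 1)) ^ (4 * n) ≤ α * C ^ n * (n ! : ℝ) ^ γ :=
    Admissible.of_le_pow (c := 24 * (Λ + 1)) (by positivity) 4 0 fun n _ => by rw [add_zero]
  have a48 : ∃ α C : ℝ, ∃ γ : ℕ, 0 ≤ α ∧ 0 ≤ C ∧ ∀ n : ℕ, 1 ≤ n →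
      (48 * (Λ + 1)) ^ (4 * n) ≤ α * C ^ n * (n ! : ℝ) ^ γ :=
    Admissible.of_le_pow (c := 48 * (Λ + 1)) (by positivity) 4 0 fun n _ => by rw [add_zero]
  have an2 : ∃ α C : ℝ, ∃ γ : ℕ, 0 ≤ α ∧ 0 ≤ C ∧ ∀ n : ℕ, 1 ≤ n →
      (n : ℝ) ^ 2 ≤ α * C ^ n * (n ! : ℝ) ^ γ :=
    Admissible.of_le_natPow 2 fun n _ => le_rfl
  have a64 : ∃ α C : ℝ, ∃ γ : ℕ, 0 ≤ α ∧ 0 ≤ C ∧ ∀ n : ℕ, 1 ≤ n →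
      (64 * (Λ + 1) + 11 : ℝ) ^ 4 ≤ α * C ^ n * (n ! : ℝ) ^ γ :=
    Admissible.of_le_const (by positivity) fun n _ => le_rfl
  -- composition (products of non-negative admissible factors, then the sum)
  refine Admissible.add ?_ (Admissible.const_mul (by norm_num) ?_)
  · refine Admissible.mul (fun n hn => by positivity) (Admissible.mul (fun n hn => by positivity) a2a a24) ?_
    refine Admissible.mul (fun n hn => by positivity) aFac ?_
    exact Admissible.mul hQ0 (Admissible.mul (fun n hn => by positivity) a2K a2b) aQ
  · refine Admissible.mul (fun n hn => by positivity) ?_ ?_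
    · refine Admissible.mul (fun n hn => by positivity) a2c ?_
      exact Admissible.mul (fun n hn => by positivity) (Admissible.mul (fun n hn => by positivity) an2 a64) a48
    · refine Admissible.mul (fun n hn => by positivity) aFac ?_
      refine Admissible.mul hQ0 ?_ aQ
      exact Admissible.mul hQ0 (Admissible.mul (fun n hn => by positivity) a2K a4) aQ

end Summit.QuantumFields.YangMills.Cruxes.AtomicCalibrationR.LevelConstants

end
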